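import Literature.NumberTheory.EllipticCurves.IwasawaTwistModOmegaSq
import Literature.NumberTheory.EllipticCurves.IwasawaTwistModPkTower
import Mathlib.RingTheory.Nilpotent.Basic
import Mathlib.LinearAlgebra.Pi
import HarnessLib

/-!
# The `ω²`-projection `M ⊗ (ℤ/p^k)[T]/(T^J) → M ⊗ (ℤ/p^k)[T]/(ω_{p^m}²)` of the Iwasawa twist carriers
# (`T^J ∈ (p^k, ω_{p^m}²)` for `J ≥ p^m(k+1)`; definitions with bodies + proofs; no named fact)

Topic `NumberTheory/EllipticCurves` (sequel of `IwasawaTwistModPk` = T-es-6 (a) and `IwasawaTwistModOmegaSq`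
= T-es-6 (b)); namespaces `Literature.NumberTheory.EllipticCurves` (pure algebra on the carriers) and
`….ZpExtension` (the equivariant map).  Cell `bsd-f3-mu` (crux `KatoDivisibilityX9` = item
stmt-BirchSwinnertonDyer-20547, line `graded_euler_loss`, stub `stub_reciprocityPkX9` = hG34ᵍ): that stub hands
the test class over «at T6a-level `2e(d+1)`, which projects to the `ω²`-carrier since `T^{2e(d+1)} ∈ (p^{d+1}, ω²)`»
(its docstring; the ring identity is the Summits-side `…GradedCoreAlgebra.pow_mem_span_prime_pow_omega_sq`).  This
file supplies that PROJECTION at the level of the carriers and of `H¹`, i.e. the glue between the two typed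
carriers `κ.twistModPk ρ hM J` (`Fin J → M`, `T` = the shift `S`) and `κ.twistModOmegaSq ρ hM m`
(`Fin (2·p^m) → M`, `T` = the companion operator `S_ω` of `ω_{p^m}²`), for a `p^k`-torsion discrete `Γ_K`-module
`M` (`hM : ∀ x, p^k • x = 0`).  DEFINITIONS WITH BODIES AND THEOREMS ONLY — nothing is asserted (D-0026).

* §1 **`S_ω` is nilpotent on `p^k`-torsion coefficients**: `ω_{p^m} − X^{p^m} = p·h` in `ℤ[X]`
  (`exists_omegaPoly_sub_X_pow_eq_C_mul`, from `map_omegaPoly_prime_pow`), hence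
  `S_ω^{p^m} = Ω − p·h(S_ω)` (`omegaSqShiftEnd_pow_prime_pow_eq_omegaEnd_sub`) with `Ω² = 0`
  (`omegaEnd_mul_self`) and `(p·h(S_ω))^k = 0`, so **`S_ω^{p^m(k+1)} = 0`** (`omegaSqShiftEnd_pow_eq_zero`;
  Mathlib `Commute.add_pow_eq_zero_of_add_le_succ_of_pow_eq_zero`), `…_of_le` (`S_ω^J = 0` for
  `J ≥ p^m(k+1)`) and `omegaSqShiftEnd_pow_two_mul_eq_zero` (`S_ω^{2p^m·k} = 0`, the consumer's numerology
  `J + 1 = 2e(d+1)`, `e = p^N`, `k = d+1`).  This is `T^J ∈ (p^k, ω_{p^m}²)` read on the carrier.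
* §2 **`omegaSqProj p m M J : (Fin J → M) →ₗ[ℤ] (Fin (2·p^m) → M)`**, `x ↦ Σ_{i<J} S_ω^i (x_i·T⁰)` — the map
  `M ⊗ ℤ[T]/(T^J) → M ⊗ ℤ[T]/(ω_{p^m}²)`, `Σ x_i T^i ↦ Σ x_i T^i mod ω²`, in the two `T`-bases: values on basis
  vectors (`omegaSqProj_single`, `…_single_of_lt`: `x_i T^i ↦ x_i T^i` for `i < 2p^m`), commutation with
  coordinatewise additive maps (`map_omegaSqProj_apply`), **`T`-linearity `π ∘ S = S_ω ∘ π` GIVEN `S_ω^J = 0`**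
  (`omegaSqProj_comp_shiftEnd`, `…_shiftEnd_apply`, `…_shiftEnd_pow_apply`; the hypothesis is exactly the
  well-definedness of `Λ/(T^J) → Λ/(p^k, ω²)`), `π ∘ (1+S)^a = U_a ∘ π` (`omegaSqProj_unipotentPow_apply`),
  truncation-invariance `π_J = π_{J'} ∘ (mod T^{J'})` when `S_ω^{J'} = 0` (`omegaSqProj_comp_funLeft_castLE`,
  `omegaSqProj_castLE_apply`), `shiftEmbed ∘ truncate = S^{J−J'}` on `Fin J → M` (`shiftEmbed_comp_castLE`),
  **on vectors with `p`-torsion coordinates `π` IS the truncation to `2p^m` coefficients**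
  (`omegaSqProj_apply_of_torsion`, via `omegaSqShiftEnd_pow_apply_of_torsion : S_ω^a = S^a` there), and
  surjectivity for `J ≥ 2p^m` (`omegaSqProj_surjective`).
* §3 **`κ.twistModPkToOmegaSq ρ hM J m hS : 𝒯_J^{(k)}(M) →ⁱL (ω²-carrier of M)`** (`hS : S_ω^J = 0`, e.g.
  `omegaSqShiftEnd_pow_eq_zero_of_le`), the `Γ_K`-EQUIVARIANT projection (both actions read at the common
  admissible level `J + k + 2p^m`), `…_apply`, surjectivity; and the `H¹`-level identities the graded core uses
  (via `galoisCohomology.map_map_of_comp_apply` of `IwasawaTwistModPkTower`):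
  **`map_twistModPkToOmegaSq_map_twistModPToModPk`** — `π_* ∘ (ι_k)_* = (ι_ω)_* ∘ (mod T^{2p^m})_*` for the maps
  `ι_k = twistModPToModPk f` / `ι_ω = twistModPToOmegaSq f` along `f : M' → M` out of a `p`-torsion module
  (`J ≥ 2p^m`; transports `p^d·Ψ = ι_*ψ̄`), `twistModPkShiftEmbed_twistModPkTruncate_apply`
  (`(T^{J−J'}·) ∘ (mod T^{J'}) = S^{a}` with `J' = J − a`, the shape of the stub's local conditions) and
  **`iterate_map_twistModOmegaSqShift_map_twistModPkToOmegaSq`** — `(T·)_*^{a} ∘ π_* = π_* ∘ (T^{a}·)_*`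
  on `H¹`, the right side written with `twistModPkShiftEmbed ∘ twistModPkTruncate` at level `J − a`.
* §4 the elliptic specialisation `W.modPkTwistToOmegaSq p k κ J m hS : 𝒯_J^{(k)}(E) →ⁱL (ω²-carrier of E[p^k])`
  with the dischargers `W.omegaSqShiftEnd_pow_eq_zero_of_le` / `…_two_mul_eq_zero`.

NOT HERE (honest): the kernel of `π` (`= T^{?}·𝒯 + ω²·𝒯`-type description) and any statement about Selmer /
local conditions under `π_*` (tree naturality of `galoisCohomology.localization` applies to `π` as to any `→ⁱL`).

References: L. Washington, *Introduction to Cyclotomic Fields* §7.1–7.2 (`Λ/(p^k, f)`, distinguished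
polynomials, division with remainder), §13.1–13.2 (`Γ` acting through `(1+T)^a`) [Washington1997]; B. Mazur,
K. Rubin, *Kolyvagin systems*, Mem. AMS 799 (2004) §5.3 (functoriality of `T ⊗ Λ/𝔪^kΛ`-type coefficients in the
ring) [MazurRubin2004]; J.-P. Serre, *Galois Cohomology* I §2.2 (functoriality of `H¹`) [SerreGaloisCohomology1997];
cell bsd-f3-mu MEMO-es §15 STEP 3–4, §25.3; skeleton `Cruxes/KatoDivisibilityX9/Lines/graded_euler_loss.lean` v3.
-/

noncomputable section

open scoped Topology ContRepresentation
open Field Filter Polynomial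

universe u

namespace Literature.NumberTheory.EllipticCurves

open Literature.NumberTheory.GaloisRepresentations

/-! ## §1 `S_ω` is nilpotent on `p^k`-torsion coefficients: `T^{p^m(k+1)} ∈ (p^k, ω_{p^m}²)` -/

section Nilpotent

variable (p : ℕ) [Fact p.Prime] (m : ℕ)

/-- **`ω_{p^m} ≡ X^{p^m} (mod p)` in divisibility form**: `ω_{p^m} − X^{p^m} = p · h` for some `h ∈ ℤ[X]`
(all middle binomial coefficients `C(p^m, i)`, `0 < i < p^m`, are divisible by `p`; read off
`map_omegaPoly_prime_pow` coefficientwise). [cite: Washington1997, §7.1–§7.2] -/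
theorem exists_omegaPoly_sub_X_pow_eq_C_mul :
    ∃ h : ℤ[X], omegaPoly (p ^ m) - X ^ p ^ m = C (p : ℤ) * h := by
  have hmap : (omegaPoly (p ^ m) - X ^ p ^ m).map (Int.castRingHom (ZMod p)) = 0 := by
    rw [Polynomial.map_sub, map_omegaPoly_prime_pow, Polynomial.map_pow, Polynomial.map_X, sub_self]
  have hdvd : ∀ n : ℕ, (p : ℤ) ∣ (omegaPoly (p ^ m) - X ^ p ^ m).coeff n := fun n => by
    have h := congrArg (fun f : (ZMod p)[X] => f.coeff n) hmap
    simp only [Polynomial.coeff_map, eq_intCast, Polynomial.coeff_zero] at h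
    exact (ZMod.intCast_zmod_eq_zero_iff_dvd _ _).1 h
  exact (C_dvd_iff_dvd_coeff _ _).2 hdvd

variable (M : Type*) [AddCommGroup M] {k : ℕ}

/-- **`S_ω^{p^m} = Ω − p·h(S_ω)`** on `Fin (2·p^m) → M`: evaluate `X^{p^m} = ω_{p^m} − p·h` at the companion
operator `S_ω` of `ω_{p^m}²` (`Ω = ω_{p^m}(S_ω)` is `omegaEnd`). [cite: Washington1997, §7.1–§7.2] -/
theorem omegaSqShiftEnd_pow_prime_pow_eq_omegaEnd_sub :
    ∃ h : ℤ[X], omegaSqShiftEnd p m M ^ p ^ m =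
      omegaEnd p m M - (p : Module.End ℤ (Fin (2 * p ^ m) → M)) * aeval (omegaSqShiftEnd p m M) h := by
  obtain ⟨h, hh⟩ := exists_omegaPoly_sub_X_pow_eq_C_mul p m
  refine ⟨h, ?_⟩
  have e : (X : ℤ[X]) ^ p ^ m = omegaPoly (p ^ m) - C (p : ℤ) * h := by
    rw [← hh, sub_sub_cancel]
  have := congrArg (aeval (omegaSqShiftEnd p m M)) e
  rw [map_pow, aeval_X, map_sub, map_mul, aeval_C, eq_intCast, Int.cast_natCast] at this
  rw [omegaEnd]
  exact this

variable {M}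

/-- **`S_ω^{p^m(k+1)} = 0` on `Fin (2·p^m) → M` when `p^k • M = 0`** — i.e. `T^{p^m(k+1)} ∈ (p^k, ω_{p^m}²)`:
`S_ω^{p^m} = Ω + y` with `Ω² = 0` (Cayley–Hamilton, `omegaEnd_mul_self`), `y = −p·h(S_ω)`, `y^k = 0`
(`p^k` acts by `0`), `Ω` and `y` commute (both polynomials in `S_ω`), so `(Ω + y)^{k+1} = 0`.
[cite: Washington1997, §7.1–§7.2] -/
theorem omegaSqShiftEnd_pow_eq_zero (hM : ∀ x : M, p ^ k • x = 0) :
    omegaSqShiftEnd p m M ^ (p ^ m * (k + 1)) = 0 := by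
  obtain ⟨h, hh⟩ := omegaSqShiftEnd_pow_prime_pow_eq_omegaEnd_sub p m M
  have hcomm : Commute (omegaEnd p m M)
      (-((p : Module.End ℤ (Fin (2 * p ^ m) → M)) * aeval (omegaSqShiftEnd p m M) h)) := by
    have h2 : -((p : Module.End ℤ (Fin (2 * p ^ m) → M)) * aeval (omegaSqShiftEnd p m M) h) =
        aeval (omegaSqShiftEnd p m M) (-(C (p : ℤ) * h)) := by
      rw [map_neg, map_mul, aeval_C, eq_intCast, Int.cast_natCast]
    rw [omegaEnd, h2]
    exact (Commute.all _ _).map (aeval (omegaSqShiftEnd p m M))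
  have hΩ : omegaEnd p m M ^ 2 = 0 := by
    rw [pow_two]
    exact omegaEnd_mul_self
  have hy : (-((p : Module.End ℤ (Fin (2 * p ^ m) → M)) * aeval (omegaSqShiftEnd p m M) h)) ^ k = 0 := by
    have hpk : (p : Module.End ℤ (Fin (2 * p ^ m) → M)) ^ k = 0 := by
      rw [← Nat.cast_pow]
      exact natCast_moduleEnd_eq_zero_of_pow_smul hM dvd_rfl
    rw [neg_pow, (Nat.cast_commute p _).mul_pow, hpk, zero_mul, mul_zero]
  rw [pow_mul, hh, sub_eq_add_neg]
  exact hcomm.add_pow_eq_zero_of_add_le_succ_of_pow_eq_zero hΩ hy (by omega)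

/-- Hence `S_ω^J = 0` on `Fin (2·p^m) → M` for every `J ≥ p^m(k+1)` (`p^k • M = 0`): the natural map
`M ⊗ Λ/(p^k, T^J) → M ⊗ Λ/(p^k, ω_{p^m}²)` is well defined. [cite: Washington1997, §7.1–§7.2] -/
theorem omegaSqShiftEnd_pow_eq_zero_of_le (hM : ∀ x : M, p ^ k • x = 0) {J : ℕ}
    (hJ : p ^ m * (k + 1) ≤ J) : omegaSqShiftEnd p m M ^ J = 0 :=
  pow_eq_zero_of_le hJ (omegaSqShiftEnd_pow_eq_zero p m hM)

/-- The consumer's numerology: **`S_ω^{2·p^m·k} = 0`** on `Fin (2·p^m) → M` (`p^k • M = 0`; for `k ≥ 1` since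
`p^m(k+1) ≤ 2p^m k`, for `k = 0` because `M = 0`) — `T^{2e(d+1)} ∈ (p^{d+1}, ω²)` with `e = p^m`, `k = d + 1`.
[cite: Washington1997, §7.1–§7.2] -/
theorem omegaSqShiftEnd_pow_two_mul_eq_zero (hM : ∀ x : M, p ^ k • x = 0) :
    omegaSqShiftEnd p m M ^ (2 * p ^ m * k) = 0 := by
  rcases Nat.eq_zero_or_pos k with rfl | hk
  · haveI : Subsingleton M := ⟨fun a b => by
      have ha := hM a
      have hb := hM b
      rw [pow_zero, one_smul] at ha hb
      rw [ha, hb]⟩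
    exact LinearMap.ext fun x => Subsingleton.elim _ _
  · refine omegaSqShiftEnd_pow_eq_zero_of_le p m hM ?_
    calc p ^ m * (k + 1) ≤ p ^ m * (2 * k) := Nat.mul_le_mul_left _ (by omega)
      _ = 2 * p ^ m * k := by ring

end Nilpotent

/-! ## §2 The projection `omegaSqProj : (Fin J → M) → (Fin (2·p^m) → M)`, `x ↦ Σ_i S_ω^i (x_i·T⁰)` -/

section Proj

variable (p : ℕ) [Fact p.Prime] (m : ℕ) (M : Type*) [AddCommGroup M] (J : ℕ)

/-- `0 < 2·p^m` (the `ω²`-carrier has the coordinate `T⁰`); private helper (any proof of `0 < 2·p^m` may be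
used in its place downstream, by proof irrelevance). [folklore] -/
private theorem two_mul_prime_pow_pos : 0 < 2 * p ^ m :=
  Nat.mul_pos Nat.two_pos (pow_pos (Fact.out : p.Prime).pos m)

/-- **The `ω²`-projection on carriers** `omegaSqProj p m M J : (Fin J → M) →ₗ[ℤ] (Fin (2·p^m) → M)`,
`x ↦ Σ_{i<J} S_ω^i (x_i · T⁰)`: the map `M ⊗ ℤ[T]/(T^J) → M ⊗ ℤ[T]/(ω_{p^m}²)`,
`Σ_i x_i T^i ↦ Σ_i x_i T^i mod ω_{p^m}²`, written in the `T`-bases of the two carriers (`S_ω` = multiplication by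
`T` on the target).  It is additive for every `J`; it is `T`-linear (and then `Γ_K`-equivariant, §3) exactly when
`S_ω^J = 0` on the target, i.e. for `J ≥ p^m(k+1)` on `p^k`-torsion coefficients (§1).
[cite: Washington1997, §7.1–§7.2] -/
def omegaSqProj : (Fin J → M) →ₗ[ℤ] (Fin (2 * p ^ m) → M) where
  toFun x := ∑ i : Fin J, (omegaSqShiftEnd p m M ^ (i : ℕ))
    (Pi.single (⟨0, two_mul_prime_pow_pos p m⟩ : Fin (2 * p ^ m)) (x i))
  map_add' x y := by
    simp only [Pi.add_apply, Pi.single_add, map_add, Finset.sum_add_distrib]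
  map_smul' c x := by
    simp only [Pi.smul_apply, Pi.single_smul', map_zsmul, RingHom.id_apply, Finset.smul_sum]

/-- Unfolding lemma for `omegaSqProj`. [cite: Washington1997, §7.1–§7.2] -/
theorem omegaSqProj_apply (x : Fin J → M) :
    omegaSqProj p m M J x = ∑ i : Fin J, (omegaSqShiftEnd p m M ^ (i : ℕ))
      (Pi.single (⟨0, two_mul_prime_pow_pos p m⟩ : Fin (2 * p ^ m)) (x i)) := rfl

/-- **On a basis vector**: `π(y·T^i) = S_ω^i (y·T⁰)` (`= y·T^i` reduced modulo `ω_{p^m}²`).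
[cite: Washington1997, §7.1–§7.2] -/
theorem omegaSqProj_single (i : Fin J) (y : M) :
    omegaSqProj p m M J (Pi.single i y) =
      (omegaSqShiftEnd p m M ^ (i : ℕ)) (Pi.single (⟨0, two_mul_prime_pow_pos p m⟩ : Fin (2 * p ^ m)) y) := by
  rw [omegaSqProj_apply, Finset.sum_eq_single i]
  · rw [Pi.single_eq_same]
  · intro j _ hji
    rw [Pi.single_eq_of_ne hji, Pi.single_zero, map_zero]
  · intro hi
    exact absurd (Finset.mem_univ i) hi

/-- **On a low basis vector `π` is the identity of coordinates**: `π(y·T^i) = y·T^i` for `i < 2p^m`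
(`companionEnd_pow_single_zero`). [cite: Washington1997, §7.1–§7.2] -/
theorem omegaSqProj_single_of_lt (i : Fin J) (hi : (i : ℕ) < 2 * p ^ m) (y : M) :
    omegaSqProj p m M J (Pi.single i y) = Pi.single (⟨i, hi⟩ : Fin (2 * p ^ m)) y := by
  rw [omegaSqProj_single, omegaSqShiftEnd_def, companionEnd_pow_single_zero hi]

/-! ### Commutation with coordinatewise additive maps -/

section Map

variable {M' : Type*} [AddCommGroup M'] {Φ : Type*} [FunLike Φ M M'] [AddMonoidHomClass Φ M M']

omit [Fact p.Prime] in
/-- A coordinatewise additive map commutes with the powers of `S_ω`. [cite: Washington1997, §7.1–§7.2] -/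
theorem map_omegaSqShiftEnd_pow_apply (f : Φ) (a : ℕ) (x : Fin (2 * p ^ m) → M) :
    (fun i => f ((omegaSqShiftEnd p m M ^ a) x i)) = (omegaSqShiftEnd p m M' ^ a) (fun i => f (x i)) := by
  induction a generalizing x with
  | zero => rw [pow_zero, pow_zero, Module.End.one_apply, Module.End.one_apply]
  | succ a ih =>
    rw [pow_succ, pow_succ, Module.End.mul_apply, Module.End.mul_apply, ih,
      map_omegaSqShiftEnd_apply f x]

/-- **`π` commutes with coordinatewise additive maps**: `f ∘ (π x) = π (f ∘ x)` (functoriality of the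
projection in the coefficient module; in particular `π` commutes with `ρ(g)` acting coordinatewise).
[cite: MazurRubin2004, §5.3] -/
theorem map_omegaSqProj_apply (f : Φ) (x : Fin J → M) :
    (fun j => f (omegaSqProj p m M J x j)) = omegaSqProj p m M' J (fun i => f (x i)) := by
  funext j
  rw [omegaSqProj_apply, omegaSqProj_apply, Finset.sum_apply, Finset.sum_apply, map_sum]
  refine Finset.sum_congr rfl fun i _ => ?_
  have hsingle : (fun l => f ((Pi.single (⟨0, two_mul_prime_pow_pos p m⟩ : Fin (2 * p ^ m)) (x i) :
      Fin (2 * p ^ m) → M) l)) = Pi.single (⟨0, two_mul_prime_pow_pos p m⟩ : Fin (2 * p ^ m)) (f (x i)) := by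
    funext l
    rw [Pi.apply_single (fun _ => (f : M → M')) (fun _ => map_zero f)]
  have h1 := congrFun (map_omegaSqShiftEnd_pow_apply p m M f (i : ℕ)
    (Pi.single (⟨0, two_mul_prime_pow_pos p m⟩ : Fin (2 * p ^ m)) (x i))) j
  rw [h1, hsingle]

end Map

/-! ### `T`-linearity (given `S_ω^J = 0`) and compatibility with `(1+S)^a` -/

/-- **`π ∘ S = S_ω ∘ π` as soon as `S_ω^J = 0`**: `π` is `T`-linear `M ⊗ ℤ[T]/(T^J) → M ⊗ (ℤ/p^k)[T]/(ω²)`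
(on `y·T^i`, `i + 1 < J`: both sides are `S_ω^{i+1}(y T⁰)`; on the top vector `y·T^{J−1}` the left side is
`π(0) = 0` and the right side `S_ω^J (y T⁰) = 0`). [cite: Washington1997, §7.1–§7.2] -/
theorem omegaSqProj_comp_shiftEnd (hS : omegaSqShiftEnd p m M ^ J = 0) :
    omegaSqProj p m M J ∘ₗ shiftEnd M J = omegaSqShiftEnd p m M ∘ₗ omegaSqProj p m M J := by
  refine LinearMap.pi_ext fun i y => ?_
  obtain ⟨i, hi⟩ := i
  have hJ0 : 0 < J := by omega
  rw [LinearMap.comp_apply, LinearMap.comp_apply, omegaSqProj_single, ← Module.End.mul_apply,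
    ← pow_succ', Fin.val_mk]
  by_cases hi1 : i + 1 < J
  · rw [shiftEnd_single_of_lt hi1, omegaSqProj_single, Fin.val_mk]
  · have htop : (⟨i, hi⟩ : Fin J) = ⟨J - 1, Nat.sub_lt hJ0 Nat.one_pos⟩ :=
      Fin.ext (by simp only; omega)
    rw [htop, shiftEnd_single_top hJ0 y, map_zero, show i + 1 = J by omega, hS, LinearMap.zero_apply]

/-- Pointwise form of `omegaSqProj_comp_shiftEnd`: `π(S x) = S_ω(π x)` (`S_ω^J = 0`).
[cite: Washington1997, §7.1–§7.2] -/
theorem omegaSqProj_shiftEnd_apply (hS : omegaSqShiftEnd p m M ^ J = 0) (x : Fin J → M) :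
    omegaSqProj p m M J (shiftEnd M J x) = omegaSqShiftEnd p m M (omegaSqProj p m M J x) :=
  LinearMap.congr_fun (omegaSqProj_comp_shiftEnd p m M J hS) x

/-- `π(S^a x) = S_ω^a (π x)` (`S_ω^J = 0`): `π` commutes with multiplication by `T^a`.
[cite: Washington1997, §7.1–§7.2] -/
theorem omegaSqProj_shiftEnd_pow_apply (hS : omegaSqShiftEnd p m M ^ J = 0) (a : ℕ) (x : Fin J → M) :
    omegaSqProj p m M J ((shiftEnd M J ^ a) x) = (omegaSqShiftEnd p m M ^ a) (omegaSqProj p m M J x) := by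
  induction a generalizing x with
  | zero => rw [pow_zero, pow_zero, Module.End.one_apply, Module.End.one_apply]
  | succ a ih =>
    rw [pow_succ, pow_succ, Module.End.mul_apply, Module.End.mul_apply, ih,
      omegaSqProj_shiftEnd_apply p m M J hS]

omit [Fact p.Prime] in
/-- One step of the unipotent recursion on the `ω²`-carrier: `U_{a+1} y = U_a y + S_ω (U_a y)`.
[cite: Washington1997, §13.1–§13.2] -/
theorem omegaUnipotentPow_succ_apply (a : ℕ) (y : Fin (2 * p ^ m) → M) :
    omegaUnipotentPow p m M (a + 1) y =
      omegaUnipotentPow p m M a y + omegaSqShiftEnd p m M (omegaUnipotentPow p m M a y) := by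
  rw [omegaUnipotentPow_def, omegaUnipotentPow_def, pow_succ', Module.End.mul_apply, LinearMap.add_apply,
    Module.End.one_apply]

/-- **`π ∘ (1+S)^a = U_a ∘ π`** (`S_ω^J = 0`): `π` commutes with multiplication by `γ^a = (1+T)^a`.
[cite: Washington1997, §13.1–§13.2] -/
theorem omegaSqProj_unipotentPow_apply (hS : omegaSqShiftEnd p m M ^ J = 0) (a : ℕ) (x : Fin J → M) :
    omegaSqProj p m M J (unipotentPow M J a x) = omegaUnipotentPow p m M a (omegaSqProj p m M J x) := by
  induction a generalizing x with
  | zero => rw [unipotentPow_zero, omegaUnipotentPow_zero, Module.End.one_apply, Module.End.one_apply]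
  | succ a ih =>
    rw [ZpExtension.unipotentPow_succ_apply, map_add, omegaSqProj_shiftEnd_apply p m M J hS, ih,
      omegaUnipotentPow_succ_apply]

/-! ### Change of level: truncation, `T^{J−J'}`-embedding -/

/-- **`shiftEmbed ∘ truncate = S^{J−J'}`** on `Fin J → M` (`J' ≤ J`): `T^{J−J'}·(x mod T^{J'}) = T^{J−J'}·x` in
`M ⊗ ℤ[T]/(T^J)` — the composite `twistModPkShiftEmbed ∘ twistModPkTruncate` of `IwasawaTwistModPk` is
multiplication by `T^{J−J'}`. [cite: Washington1997, §13.1–§13.2] -/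
theorem shiftEmbed_comp_castLE {J' : ℕ} (hJ' : J' ≤ J) (x : Fin J → M) :
    ZpExtension.shiftEmbed J hJ' (fun i => x (Fin.castLE hJ' i)) = (shiftEnd M J ^ (J - J')) x := by
  funext l
  rw [ZpExtension.shiftEmbed_apply, shiftEnd_pow_apply]
  by_cases h : J - J' ≤ (l : ℕ)
  · rw [dif_pos h, dif_neg (not_lt.2 h)]
    rfl
  · rw [dif_neg h, dif_pos (not_le.1 h)]

/-- A basis vector of `Fin J → M` truncated to the first `J'` coordinates: `y·T^i ↦ y·T^i` if `i < J'`;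
private helper. [folklore] -/
private theorem single_comp_castLE_of_lt {J' : ℕ} (hJ' : J' ≤ J) {i : ℕ} (hi : i < J) (hiJ' : i < J') (y : M) :
    (fun l : Fin J' => (Pi.single (⟨i, hi⟩ : Fin J) y : Fin J → M) (Fin.castLE hJ' l)) =
      Pi.single (⟨i, hiJ'⟩ : Fin J') y := by
  funext l
  simp only [Pi.single_apply, Fin.ext_iff, Fin.val_castLE]

/-- A basis vector of `Fin J → M` truncated to the first `J'` coordinates: `y·T^i ↦ 0` if `J' ≤ i`;
private helper. [folklore] -/
private theorem single_comp_castLE_of_le {J' : ℕ} (hJ' : J' ≤ J) {i : ℕ} (hi : i < J) (hiJ' : J' ≤ i) (y : M) :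
    (fun l : Fin J' => (Pi.single (⟨i, hi⟩ : Fin J) y : Fin J → M) (Fin.castLE hJ' l)) = 0 := by
  funext l
  simp only [Pi.single_apply, Fin.ext_iff, Fin.val_castLE, Pi.zero_apply]
  rw [if_neg]
  have := l.2
  omega

/-- **Truncation invariance**: `π_J = π_{J'} ∘ (x ↦ x mod T^{J'})` for `J' ≤ J` with `S_ω^{J'} = 0` (the higher
coefficients `x_i T^i`, `i ≥ J'`, die in `Λ/(p^k, ω²)`), as an identity of linear maps
(`LinearMap.funLeft ℤ M (Fin.castLE hJ')` is the truncation). [cite: Washington1997, §7.1–§7.2] -/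
theorem omegaSqProj_comp_funLeft_castLE {J' : ℕ} (hJ' : J' ≤ J) (hS : omegaSqShiftEnd p m M ^ J' = 0) :
    omegaSqProj p m M J' ∘ₗ LinearMap.funLeft ℤ M (Fin.castLE hJ') = omegaSqProj p m M J := by
  refine LinearMap.pi_ext fun i y => ?_
  obtain ⟨i, hi⟩ := i
  rw [LinearMap.comp_apply, omegaSqProj_single, Fin.val_mk]
  change omegaSqProj p m M J' (fun l : Fin J' => (Pi.single (⟨i, hi⟩ : Fin J) y : Fin J → M)
    (Fin.castLE hJ' l)) = _
  by_cases hiJ' : i < J'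
  · rw [single_comp_castLE_of_lt M J hJ' hi hiJ', omegaSqProj_single, Fin.val_mk]
  · rw [single_comp_castLE_of_le M J hJ' hi (not_lt.1 hiJ'), map_zero,
      pow_eq_zero_of_le (not_lt.1 hiJ') hS, LinearMap.zero_apply]

/-- Pointwise form of the truncation invariance: `π_{J'}(x mod T^{J'}) = π_J(x)` (`J' ≤ J`, `S_ω^{J'} = 0`).
[cite: Washington1997, §7.1–§7.2] -/
theorem omegaSqProj_castLE_apply {J' : ℕ} (hJ' : J' ≤ J) (hS : omegaSqShiftEnd p m M ^ J' = 0)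
    (x : Fin J → M) :
    omegaSqProj p m M J' (fun i => x (Fin.castLE hJ' i)) = omegaSqProj p m M J x :=
  LinearMap.congr_fun (omegaSqProj_comp_funLeft_castLE p m M J hJ' hS) x

/-! ### Vectors with `p`-torsion coordinates: `π` is the plain truncation to `2p^m` coefficients -/

/-- On vectors with `p`-torsion coordinates every power of `S_ω` is the corresponding power of the plain shift
(`S_ω ≡ S (mod p)`, `omegaSqShiftEnd_apply_of_torsion`, and `S` preserves such vectors).
[cite: Washington1997, §7.1–§7.2] -/
theorem omegaSqShiftEnd_pow_apply_of_torsion (a : ℕ) (y : Fin (2 * p ^ m) → M) (hy : ∀ i, p • y i = 0) :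
    (omegaSqShiftEnd p m M ^ a) y = (shiftEnd M (2 * p ^ m) ^ a) y := by
  induction a generalizing y with
  | zero => rw [pow_zero, pow_zero]
  | succ a ih =>
    have hSy : ∀ i, p • shiftEnd M (2 * p ^ m) y i = 0 := fun i => by
      rw [shiftEnd_apply]
      split_ifs
      · exact smul_zero _
      · exact hy _
    rw [pow_succ, pow_succ, Module.End.mul_apply, Module.End.mul_apply,
      omegaSqShiftEnd_apply_of_torsion y hy, ih _ hSy]

/-- **On a vector with `p`-torsion coordinates, `π` IS the truncation `x ↦ (x_0, …, x_{2p^m−1})`** (`J ≥ 2p^m`):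
`π(x_i T^i) = x_i T^i` for `i < 2p^m` and `= S^i(x_i T⁰) = 0` for `i ≥ 2p^m` (`ω_{p^m}² ≡ T^{2p^m} (mod p)`).  This
identifies `π ∘ ι_k` with `ι_ω ∘ (mod T^{2p^m})` on the mod-`p` models (§3). [cite: Washington1997, §7.1–§7.2] -/
theorem omegaSqProj_apply_of_torsion (hJ : 2 * p ^ m ≤ J) (x : Fin J → M) (hx : ∀ i, p • x i = 0) :
    omegaSqProj p m M J x = fun j => x (Fin.castLE hJ j) := by
  have hterm : ∀ (i : Fin J) (j : Fin (2 * p ^ m)),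
      (omegaSqShiftEnd p m M ^ (i : ℕ))
        (Pi.single (⟨0, two_mul_prime_pow_pos p m⟩ : Fin (2 * p ^ m)) (x i)) j =
      if (i : ℕ) = (j : ℕ) then x i else 0 := by
    intro i j
    by_cases h : (i : ℕ) < 2 * p ^ m
    · rw [omegaSqShiftEnd_def, companionEnd_pow_single_zero h, Pi.single_apply]
      simp only [Fin.ext_iff, eq_comm]
    · have htor : ∀ l, p • (Pi.single (⟨0, two_mul_prime_pow_pos p m⟩ : Fin (2 * p ^ m)) (x i) :
          Fin (2 * p ^ m) → M) l = 0 := fun l => by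
        rw [Pi.apply_single (fun _ => fun z : M => p • z) (fun _ => smul_zero _), hx, Pi.single_zero,
          Pi.zero_apply]
      rw [omegaSqShiftEnd_pow_apply_of_torsion p m M _ _ htor, shiftEnd_pow_eq_zero (not_lt.1 h),
        LinearMap.zero_apply, Pi.zero_apply, if_neg]
      have := j.2
      omega
  funext j
  rw [omegaSqProj_apply, Finset.sum_apply, Finset.sum_eq_single (Fin.castLE hJ j)]
  · rw [hterm, if_pos (Fin.val_castLE hJ j)]
  · intro i _ hij
    rw [hterm, if_neg]
    intro h
    exact hij (Fin.ext (by rw [h, Fin.val_castLE]))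
  · intro h
    exact absurd (Finset.mem_univ _) h

/-- **`π` is surjective for `J ≥ 2p^m`** (every `z = Σ_{j<2p^m} z_j T^j` is `π(Σ_j z_j T^j)`).
[cite: Washington1997, §7.1–§7.2] -/
theorem omegaSqProj_surjective (hJ : 2 * p ^ m ≤ J) : Function.Surjective (omegaSqProj p m M J) := by
  intro z
  refine ⟨∑ j : Fin (2 * p ^ m), Pi.single (Fin.castLE hJ j) (z j), ?_⟩
  rw [map_sum]
  conv_rhs => rw [← Finset.univ_sum_single z]
  refine Finset.sum_congr rfl fun j _ => ?_
  rw [omegaSqProj_single_of_lt p m M J (Fin.castLE hJ j) (by rw [Fin.val_castLE]; exact j.2) (z j)]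
  congr 1

end Proj

/-! ## §3 The `Γ_K`-equivariant projection `𝒯_J^{(k)}(M) → (ω²-carrier of M)` and its `H¹`-level identities -/

namespace ZpExtension

variable {K : Type u} [Field K] {p : ℕ} [Fact p.Prime] (κ : ZpExtension K p)

variable {M : Type u} [AddCommGroup M] [TopologicalSpace M] [DiscreteTopology M] {k : ℕ}

/-- `m ≤ 2·p^m`; private helper for admissible exponent levels. [folklore] -/
private theorem le_two_mul_prime_pow' (m : ℕ) : m ≤ 2 * p ^ m :=
  (Nat.lt_pow_self (Fact.out : p.Prime).one_lt).le.trans (Nat.le_mul_of_pos_left _ Nat.two_pos)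

/-- `J ≤ p^N` as soon as `J ≤ N`; private helper. [folklore] -/
private theorem le_prime_pow_of_le' {J N : ℕ} (h : J ≤ N) : J ≤ p ^ N :=
  h.trans (Nat.lt_pow_self (Fact.out : p.Prime).one_lt).le

variable (ρ : DiscreteGaloisModule K M) (hM : ∀ x : M, p ^ k • x = 0) (J m : ℕ)

/-- **THE `ω²`-PROJECTION `π : 𝒯_J^{(k)}(M) = M ⊗ (ℤ/p^k)[T]/(T^J)(χ_κ) → M ⊗ (ℤ/p^k)[T]/(ω_{p^m}²)(χ_κ)`** as a
continuous `Γ_K`-equivariant map (`κ.twistModPkToOmegaSq ρ hM J m hS`; Mathlib `ContIntertwiningMap`, usable in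
`galoisCohomology.map`), under the well-definedness hypothesis `hS : S_ω^J = 0` on the target (e.g.
`omegaSqShiftEnd_pow_eq_zero_of_le p m hM : p^m(k+1) ≤ J → S_ω^J = 0`, or `omegaSqShiftEnd_pow_two_mul_eq_zero`
for `J = 2p^m k`).  On carriers it is `omegaSqProj` (`x ↦ Σ_i S_ω^i(x_i T⁰)`); equivariance: both actions are
`(1+T)^{κ(g)} ∘ ρ(g)` (read at the common admissible level `J + k + 2p^m`) and `π` is `ℤ[T]`-linear and commutes
with `ρ(g)` coordinatewise.  This is the map by which a class on the T-es-6 (a) carrier of level `J` reaches the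
`ω²`-carrier of T-es-6 (b) («`T^{2e(d+1)} ∈ (p^{d+1}, ω²)`», stub `stub_reciprocityPkX9`).
[cite: MazurRubin2004, §5.3] -/
def twistModPkToOmegaSq (hS : omegaSqShiftEnd p m M ^ J = 0) :
    (κ.twistModPk ρ hM J).toContRepresentation →ⁱL (κ.twistModOmegaSq ρ hM m).toContRepresentation where
  toContinuousLinearMap :=
    { omegaSqProj p m M J with
      cont := continuous_of_discreteTopology }
  isIntertwining' g := by
    refine ContinuousLinearMap.ext fun x => ?_
    change omegaSqProj p m M J (κ.twistModPk ρ hM J g x) =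
      κ.twistModOmegaSq ρ hM m g (omegaSqProj p m M J x)
    have hm := le_two_mul_prime_pow' (p := p) m
    rw [κ.twistModPk_apply_of_level ρ hM J (N := J + k + 2 * p ^ m) (le_prime_pow_of_le' (by omega)) g,
      κ.twistModOmegaSq_apply_of_level ρ hM m (N := J + k + 2 * p ^ m) (by omega) g,
      omegaSqProj_unipotentPow_apply p m M J hS, map_omegaSqProj_apply p m M J (ρ g) x]

/-- Unfolding lemma for `twistModPkToOmegaSq`: on carriers it is `omegaSqProj`. [cite: MazurRubin2004, §5.3] -/
@[simp] theorem twistModPkToOmegaSq_apply (hS : omegaSqShiftEnd p m M ^ J = 0) (x : Fin J → M) :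
    κ.twistModPkToOmegaSq ρ hM J m hS x = omegaSqProj p m M J x := rfl

/-- `π` is surjective for `J ≥ 2p^m`. [cite: MazurRubin2004, §5.3] -/
theorem twistModPkToOmegaSq_surjective (hS : omegaSqShiftEnd p m M ^ J = 0) (hJ : 2 * p ^ m ≤ J) :
    Function.Surjective (κ.twistModPkToOmegaSq ρ hM J m hS) :=
  omegaSqProj_surjective p m M J hJ

/-- **`(T^{J−J'}·) ∘ (mod T^{J'}) = T^a·` on `𝒯_J^{(k)}` with `J' = J − a`**: the composite
`twistModPkShiftEmbed ∘ twistModPkTruncate` at level `J − a` (the shape in which the graded core states its local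
conditions, `ε = a`) is the `a`-th power of the shift (for `a > J` both sides vanish).
[cite: Washington1997, §13.1–§13.2] -/
theorem twistModPkShiftEmbed_twistModPkTruncate_apply (a : ℕ) (x : Fin J → M) :
    κ.twistModPkShiftEmbed ρ hM J (Nat.sub_le J a) (κ.twistModPkTruncate ρ hM J (Nat.sub_le J a) x) =
      (shiftEnd M J ^ a) x := by
  change ZpExtension.shiftEmbed J (Nat.sub_le J a) (fun i => x (Fin.castLE (Nat.sub_le J a) i)) = _
  rw [shiftEmbed_comp_castLE]
  rcases le_or_gt a J with h | h
  · rw [Nat.sub_sub_self h]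
  · rw [shiftEnd_pow_eq_zero (by omega : J ≤ J - (J - a)), shiftEnd_pow_eq_zero h.le]

/-- **`(T·)_*^{a} ∘ π_* = π_* ∘ (T^a·)_*` on `H¹`**, the right side written with
`twistModPkShiftEmbed ∘ twistModPkTruncate` at level `J − a` (`= T^a·` on `𝒯_J^{(k)}`): for a class `c` on the
T-es-6 (a) carrier, `(T·)^{a} π_* c = π_* (T^{a} c)` — so a vanishing `loc_v(T^ε Ψ) = 0` upstairs gives
`T^ε · loc_v(π_* Ψ) = 0` on the `ω²`-carrier (with the tree's naturality of localisation).
[cite: SerreGaloisCohomology1997, I §2.2] -/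
theorem iterate_map_twistModOmegaSqShift_map_twistModPkToOmegaSq (hS : omegaSqShiftEnd p m M ^ J = 0)
    (a : ℕ) (c : galoisCohomology (κ.twistModPk ρ hM J) 1) :
    (galoisCohomology.map (κ.twistModOmegaSqShift ρ hM m) 1)^[a]
        (galoisCohomology.map (κ.twistModPkToOmegaSq ρ hM J m hS) 1 c) =
      galoisCohomology.map (κ.twistModPkToOmegaSq ρ hM J m hS) 1
        (galoisCohomology.map (κ.twistModPkShiftEmbed ρ hM J (Nat.sub_le J a)) 1
          (galoisCohomology.map (κ.twistModPkTruncate ρ hM J (Nat.sub_le J a)) 1 c)) := by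
  -- both sides are `H¹` of the single equivariant map `π ∘ (T^a ·)`
  have key : ∀ b : ℕ, (galoisCohomology.map (κ.twistModOmegaSqShift ρ hM m) 1)^[b]
      (galoisCohomology.map (κ.twistModPkToOmegaSq ρ hM J m hS) 1 c) =
      galoisCohomology.map ((κ.twistModPkToOmegaSq ρ hM J m hS).comp
        ((κ.twistModPkShiftEmbed ρ hM J (Nat.sub_le J b)).comp
          (κ.twistModPkTruncate ρ hM J (Nat.sub_le J b)))) 1 c := by
    intro b
    induction b with
    | zero =>
      rw [Function.iterate_zero_apply]
      refine galoisCohomology.map_congr_apply _ _ (fun x => ?_) c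
      change omegaSqProj p m M J x = omegaSqProj p m M J
        (κ.twistModPkShiftEmbed ρ hM J (Nat.sub_le J 0) (κ.twistModPkTruncate ρ hM J (Nat.sub_le J 0) x))
      rw [twistModPkShiftEmbed_twistModPkTruncate_apply, pow_zero, Module.End.one_apply]
    | succ b ih =>
      rw [Function.iterate_succ_apply', ih]
      refine galoisCohomology.map_map_of_comp_apply _ _ _ (fun x => ?_) c
      change omegaSqProj p m M J (κ.twistModPkShiftEmbed ρ hM J (Nat.sub_le J (b + 1))
          (κ.twistModPkTruncate ρ hM J (Nat.sub_le J (b + 1)) x)) =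
        omegaSqShiftEnd p m M (omegaSqProj p m M J (κ.twistModPkShiftEmbed ρ hM J (Nat.sub_le J b)
          (κ.twistModPkTruncate ρ hM J (Nat.sub_le J b) x)))
      rw [twistModPkShiftEmbed_twistModPkTruncate_apply, twistModPkShiftEmbed_twistModPkTruncate_apply,
        omegaSqProj_shiftEnd_pow_apply p m M J hS, omegaSqProj_shiftEnd_pow_apply p m M J hS,
        ← Module.End.mul_apply, ← pow_succ']
  rw [key a, galoisCohomology.map_map_of_comp_apply _ _
      ((κ.twistModPkShiftEmbed ρ hM J (Nat.sub_le J a)).comp (κ.twistModPkTruncate ρ hM J (Nat.sub_le J a)))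
      (fun _ => rfl) c,
    galoisCohomology.map_map_of_comp_apply _ _
      ((κ.twistModPkToOmegaSq ρ hM J m hS).comp ((κ.twistModPkShiftEmbed ρ hM J (Nat.sub_le J a)).comp
        (κ.twistModPkTruncate ρ hM J (Nat.sub_le J a)))) (fun _ => rfl) c]

section ModP

variable {M' : Type u} [AddCommGroup M'] [TopologicalSpace M'] [DiscreteTopology M']
  (ρ' : DiscreteGaloisModule K M') (hM1 : ∀ x : M', p • x = 0)

/-- **`π ∘ ι_k = ι_ω ∘ (mod T^{2p^m})` on carriers** (`J ≥ 2p^m`): for an equivariant `f : M' → M` out of a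
`p`-torsion module (e.g. `E[p] ⊂ E[p^k]`), projecting the image of `x ∈ 𝒯_J(M')` under
`ι_k = twistModPToModPk f` equals `ι_ω = twistModPToOmegaSq f` applied to the truncation of `x` to `2p^m`
coefficients (`omegaSqProj_apply_of_torsion`). [cite: MazurRubin2004, §5.3] -/
theorem twistModPkToOmegaSq_twistModPToModPk_apply (hS : omegaSqShiftEnd p m M ^ J = 0) (hJ : 2 * p ^ m ≤ J)
    (f : ρ'.toContRepresentation →ⁱL ρ.toContRepresentation) (x : Fin J → M') :
    κ.twistModPkToOmegaSq ρ hM J m hS (κ.twistModPToModPk ρ' J ρ hM1 hM f x) =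
      κ.twistModPToOmegaSq ρ hM m ρ' hM1 f (κ.twistModPTruncate ρ' hM1 J hJ x) := by
  change omegaSqProj p m M J (fun i => f (x i)) = fun j => f (x (Fin.castLE hJ j))
  have htor : ∀ i, p • f (x i) = 0 := fun i => by rw [← map_nsmul, hM1, map_zero]
  rw [omegaSqProj_apply_of_torsion p m M J hJ _ htor]

/-- **`π_* ∘ (ι_k)_* = (ι_ω)_* ∘ (mod T^{2p^m})_*` on `H¹`** (`J ≥ 2p^m`): the transport of a relation
`p^d · Ψ = (ι_k)_* ψ̄` on the T-es-6 (a) carrier to the `ω²`-carrier reads `p^d · π_*Ψ = (ι_ω)_* (ψ̄ mod T^{2p^m})`,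
with `ι_ω = twistModPToOmegaSq f` the map of `IwasawaTwistModOmegaSq` §5 (whose `ι_*` is injective when the
invariants of the `ω²`-carrier of the cokernel vanish). [cite: SerreGaloisCohomology1997, I §2.2] -/
theorem map_twistModPkToOmegaSq_map_twistModPToModPk (hS : omegaSqShiftEnd p m M ^ J = 0) (hJ : 2 * p ^ m ≤ J)
    (f : ρ'.toContRepresentation →ⁱL ρ.toContRepresentation) (c : galoisCohomology (κ.twistModP ρ' hM1 J) 1) :
    galoisCohomology.map (κ.twistModPkToOmegaSq ρ hM J m hS) 1
        (galoisCohomology.map (κ.twistModPToModPk ρ' J ρ hM1 hM f) 1 c) =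
      galoisCohomology.map (κ.twistModPToOmegaSq ρ hM m ρ' hM1 f) 1
        (galoisCohomology.map (κ.twistModPTruncate ρ' hM1 J hJ) 1 c) := by
  have key : ∀ x, ((κ.twistModPToOmegaSq ρ hM m ρ' hM1 f).comp (κ.twistModPTruncate ρ' hM1 J hJ)) x =
      κ.twistModPkToOmegaSq ρ hM J m hS (κ.twistModPToModPk ρ' J ρ hM1 hM f x) :=
    fun x => (κ.twistModPkToOmegaSq_twistModPToModPk_apply ρ hM J m ρ' hM1 hS hJ f x).symm
  rw [galoisCohomology.map_map_of_comp_apply _ _ _ key c,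
    galoisCohomology.map_map_of_comp_apply _ _
      ((κ.twistModPToOmegaSq ρ hM m ρ' hM1 f).comp (κ.twistModPTruncate ρ' hM1 J hJ)) (fun _ => rfl) c]

end ModP

end ZpExtension

end Literature.NumberTheory.EllipticCurves

/-! ## §4 The elliptic specialisation: `𝒯_J^{(k)}(E) → E[p^k] ⊗ (ℤ/p^k)[T]/(ω_{p^m}²)` -/

namespace WeierstrassCurve

open Literature.NumberTheory.EllipticCurves Literature.NumberTheory.GaloisRepresentations

variable {F : Type u} [Field F] (W : WeierstrassCurve F) (p : ℕ) [Fact p.Prime] (k : ℕ)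
  (κ : ZpExtension F p) (J m : ℕ)

/-- `S_ω^J = 0` on the `ω²`-carrier coordinates `Fin (2·p^m) → E[p^k]` for `J ≥ p^m(k+1)` (discharger of the
hypothesis `hS` of `modPkTwistToOmegaSq`). [cite: Washington1997, §7.1–§7.2] -/
theorem omegaSqShiftEnd_geomTorsion_pow_eq_zero_of_le (hJ : p ^ m * (k + 1) ≤ J) :
    omegaSqShiftEnd p m (geomTorsion W ((p : ℤ) ^ k)) ^ J = 0 :=
  omegaSqShiftEnd_pow_eq_zero_of_le p m (W.pow_nsmul_geomTorsion_eq_zero p k) hJ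

/-- `S_ω^{2p^m k} = 0` on `Fin (2·p^m) → E[p^k]` (the level `2e(d+1)`, `e = p^m`, `k = d+1`, of the graded core).
[cite: Washington1997, §7.1–§7.2] -/
theorem omegaSqShiftEnd_geomTorsion_pow_two_mul_eq_zero :
    omegaSqShiftEnd p m (geomTorsion W ((p : ℤ) ^ k)) ^ (2 * p ^ m * k) = 0 :=
  omegaSqShiftEnd_pow_two_mul_eq_zero p m (W.pow_nsmul_geomTorsion_eq_zero p k)

/-- **`π : 𝒯_J^{(k)}(E) = E[p^k] ⊗ (ℤ/p^k)[T]/(T^J)(χ_κ) → E[p^k] ⊗ (ℤ/p^k)[T]/(ω_{p^m}²)(χ_κ)`**, the `ω²`-projection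
for the `p^k`-torsion of a Weierstrass curve (`ZpExtension.twistModPkToOmegaSq` on
`E[p^k] = W.torsionGaloisModule ((p : ℤ) ^ k)`), from `W.modPkTwist p k κ J` to `W.modOmegaSqTwist p k κ m`, under
`hS : S_ω^J = 0` (`omegaSqShiftEnd_geomTorsion_pow_eq_zero_of_le` / `…_two_mul_eq_zero`).
[cite: MazurRubin2004, §5.3] -/
def modPkTwistToOmegaSq (hS : omegaSqShiftEnd p m (geomTorsion W ((p : ℤ) ^ k)) ^ J = 0) :
    (W.modPkTwist p k κ J).toContRepresentation →ⁱL (W.modOmegaSqTwist p k κ m).toContRepresentation :=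
  κ.twistModPkToOmegaSq (W.torsionGaloisModule ((p : ℤ) ^ k)) (W.pow_nsmul_geomTorsion_eq_zero p k) J m hS

/-- Unfolding lemma: on carriers `W.modPkTwistToOmegaSq` is `omegaSqProj`. [cite: MazurRubin2004, §5.3] -/
@[simp] theorem modPkTwistToOmegaSq_apply (hS : omegaSqShiftEnd p m (geomTorsion W ((p : ℤ) ^ k)) ^ J = 0)
    (x : Fin J → geomTorsion W ((p : ℤ) ^ k)) :
    W.modPkTwistToOmegaSq p k κ J m hS x = omegaSqProj p m (geomTorsion W ((p : ℤ) ^ k)) J x := rfl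

end WeierstrassCurve

end
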